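/- Copyright: the b2b-balaban cell (near-miss cell 7), T⁴-continuum fan-out; row NE7b ROUND-2 swarm, seat
t4-ne7b-formalise-leaf-06 (gen 7) (road W-RP, sub-row «W-LAB», file 5: a run on ITS OWN Gibbs cube tower read by a term
label and ONE template reader ⇒ W7 v1.1's `GibbsCubeEvents` BY NAME; INTENT journal l.17482).  Released under the
licence of the surrounding project. -/
import Summits.QuantumFields.BalabanUV.T4Continuum.Support.HistoryChessboardGibbsSide
import Summits.QuantumFields.BalabanUV.T4Continuum.Support.HistoryChessboardLabelsReader

/-!
# Road W-RP, sub-row «W-LAB», file 5: A RUN READ BY A TERM LABEL AND ONE TEMPLATE READER ⇒ W7's `GibbsCubeEvents`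

Summits-side support leaf of the T⁴-continuum cell (rung (B)+1 on a FINITE torus only; NOT infinite volume, NOT the
mass gap, NOT the Clay statement; NOT a proof of the spine estimate NE7b).  Row NE7b, road **W-RP** (R-OWNER-23-2 ∕
R-OWNER-23-8), sub-row «W-LAB», file 5 = files 3 and 4 composed on the data's own towers: W7 v1.1's string-independent
TEN-clause `GibbsCubeEvents` (leaf-03 g5, `HistoryChessboardGibbsSide`) from EIGHT clauses on a term label `term` and a
template READER `f` of the Gibbs cube tower `gibbsTower D g₀ K`, by file 1's fibre lemmas, file 4's reader lemmas and
leaf-04 g7's 4t cube template theorems (`tEvent_E_meas_cubes`∕`tEvent_loc_cubes`∕`tEvent_sym_cubes`) BY NAME.  [folklore]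
bookkeeping over TREE theorems; ONE hypothesis SHAPE `structure GibbsReaderEvents … : Prop` (consumed only as a binder);
no definition of data, no `[cite:]` tag, no `Prop`-valued FACT minted (c1), no constant (c2∕c6), no exit ∕ socket ∕
`HistoryConstants` file touched (c3); nothing of W7 ∕ 4t ∕ W3o ∕ files 1–4 restated.

WHAT.  **`structure GibbsReaderEvents D g₀ hm₁ K P T Bad term f r`** — EIGHT clauses: `bad_subset`, `range`, `term_meas`,
the pointwise `bad_lab`, the reader's `read_meas` (bad fibres are events of the reference cube column
`towerBox G K (L^{m₁}) K`) and `read_sym` (pointwise reflection symmetry per axis), `univ_le` ((U1)+(G2)), `r_nonneg`;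
**`GibbsReaderEvents.gibbsCubeEvents`** (W7 v1.1's ten), **`GibbsReaderEvents.side (os)`** (W7's eleven with the weights
DEFINED by `weight`, for every loop string), the partition BY NAME (`ev_meas`∕`ev_cover`∕`ev_disj`).

HONEST SCOPE (R-OWNER-23-8 wording for road W-RP).  With W7 (file 2 `ChessboardGibbsWitness`) the per-run, per-cutoff
display of road W for a READER-LABELLED run is EXACTLY these eight clauses: WHICH reader `f` of the reference cube column
and WHICH term label (that Bałaban's large-field classes per cube ARE the reader's fibres and his 𝐑-operation terms the
label's fibres — (EXT) proper; in print the terms carry 𝐑-operations and analytic continuations, not bare characteristic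
functions), `bad_lab`, `read_meas`, `read_sym`, `univ_le` ((B)'s content as a READING), `bad_subset`∕`range`∕`term_meas`∕
`r_nonneg`; + per string NE7c's `shell` ∕ NE7's `budget` on the DEFINED weights + the summable rates.  Nothing of H3 ∕ (B)
∕ BetaPertH discharged; 0∕9 unchanged.  NE7b NOT proved; spine 0∕9.  HONEST DEPENDENCY (cell): continuum YM on T⁴ ⇐
BetaPertH ∧ nine spine estimates (0/9 proved); BetaPertH ⇐ (D1) ∧ (D4) ∧ CAP+tail; G-an2-4 gates asym, D1 and NE2/3/4.
This file changes none of it.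
-/

open Finset MeasureTheory Literature.Barriers.CriticalPhenomena.NonGibbs Literature.Probability.LatticeModels
open Literature.MathematicalPhysics.QuantumFieldTheory.Balaban1983to89
open Literature.MathematicalPhysics.QuantumFieldTheory.Balaban1983to89.Missing
open Literature.MathematicalPhysics.QuantumFieldTheory.Balaban1983to89.T4Continuum
open Summit.QuantumFields.BalabanUV.T4Continuum HistoryChessboardEventsSplit HistoryChessboardEventsTower
open HistoryChessboardEventsCubes HistoryRPTowerLaw HistoryRPTowerCuts HistoryRPTowerTemplates HistoryRPTowerUniform
open HistoryChessboardEventsTemplates HistoryChessboardTowerRepr HistoryChessboardGibbsSide HistoryChessboardLabels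
open HistoryChessboardLabelsReader

namespace Summit.QuantumFields.BalabanUV.T4Continuum.HistoryChessboardLabelsGibbsReader

noncomputable section

variable {F : T4Family} {G : Type*} [GaugeGroup G] [MeasurableSpace G] [HaarData G] {ι Λ : Type*}

/-- **THE READER EVENTS READING OF ONE RUN ON ITS OWN GIBBS CUBE TOWER** (HYPOTHESIS SHAPE — NOTHING asserted): the term
events are the fibres of `term`, the bad-label event of the cube `c` is «the reader `f`, applied to the tower carried
back by the cube's corner, reads `l`»; EIGHT clauses. [folklore] -/
structure GibbsReaderEvents (D : FiniteEpsData F G) (g₀ : ℕ → ℝ) {m₁ : ℕ} (hm₁ : m₁ ≤ F.m) (K : ℕ) (P : Finset Λ)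
    (T : Finset ι) (Bad : Finset ι) (term : Tower (F.P K) G K → ι) (f : Tower (F.P K) G K → Λ) (r : ℝ) : Prop where
  /-- the bad class consists of terms -/
  bad_subset : Bad ⊆ T
  /-- every state of the tower belongs to a term of `T` -/
  range : ∀ ω, term ω ∈ T
  /-- term events are measurable -/
  term_meas : ∀ τ ∈ T, MeasurableSet (term ⁻¹' {τ})
  /-- (EXT)∘(LOC), pointwise: a state in a bad term reads a bad label at some cube -/
  bad_lab : ∀ ω, term ω ∈ Bad →
    ∃ c : BlockIdx 4 (cubeCount F m₁), f (towerTranslate K (cubeCorner (sitesPerDir_top_eq F hm₁ K) c) ω) ∈ P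
  /-- (LOC): the reader's bad fibres are events of the reference cube column -/
  read_meas : ∀ l ∈ P, MeasurableSet[towerBox G K (F.L ^ m₁) K] (f ⁻¹' {l})
  /-- (R-sym), pointwise: the reader on the reflected tower = the reader on the tower carried to the mirror cube -/
  read_sym : ∀ (i : Fin 4) (ω : Tower (F.P K) G K),
    f (towerRefl i K ω) = f (towerTranslate K (-axisVec (F.P K) K i (F.L ^ m₁)) ω)
  /-- (U1)+(G2), ratio currency: the pattern «every cube reads the bad label `l`» has probability `≤ r^(N^4)` -/
  univ_le : ∀ l ∈ P, (gibbsTower D g₀ K).real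
    {ω | ∀ c : BlockIdx 4 (cubeCount F m₁), f (towerTranslate K (cubeCorner (sitesPerDir_top_eq F hm₁ K) c) ω) = l} ≤
      r ^ (cubeCount F m₁ ^ 4)
  /-- the per-cell rate is nonnegative -/
  r_nonneg : 0 ≤ r

variable {D : FiniteEpsData F G} {g₀ : ℕ → ℝ} {m₁ : ℕ} {hm₁ : m₁ ≤ F.m} {K : ℕ} {P : Finset Λ} {T : Finset ι}
  {Bad : Finset ι} {term : Tower (F.P K) G K → ι} {f : Tower (F.P K) G K → Λ} {r : ℝ}

/-- **THE READER EVENTS READING IS W7 v1.1's TEN-CLAUSE `GibbsCubeEvents`** for the fibre events: `ev_cover`∕`ev_disj`∕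
`bad_sub` by file 1's fibre lemmas (+ Mathlib's `Set.pairwiseDisjoint_fiber`), `E_meas`∕`loc`∕`sym` by 4t's cube template
theorems through file 4's reader lemmas — all BY NAME. [folklore] -/
theorem GibbsReaderEvents.gibbsCubeEvents (H : GibbsReaderEvents D g₀ hm₁ K P T Bad term f r) :
    GibbsCubeEvents D g₀ hm₁ K P T Bad (fun τ => term ⁻¹' {τ})
      (fun l c => {ω | f (towerTranslate K (cubeCorner (sitesPerDir_top_eq F hm₁ K) c) ω) = l}) r where
  bad_subset := H.bad_subset
  ev_meas := H.term_meas
  E_meas := tEvent_E_meas_cubes (sitesPerDir_top_eq F hm₁ K) (tmpl := fun l => f ⁻¹' {l}) fun l hl =>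
    measurableSet_of_towerBox (H.read_meas l hl)
  ev_cover := cover_fibre H.range
  ev_disj := Set.pairwiseDisjoint_fiber term _
  bad_sub := fibre_subset_of_bad_lab
    (lab := fun ω c => f (towerTranslate K (cubeCorner (sitesPerDir_top_eq F hm₁ K) c) ω)) H.bad_lab
  loc := tEvent_loc_cubes (Nat.le_add_left K F.m) (sitesPerDir_top_eq F hm₁ K) (tmpl := fun l => f ⁻¹' {l}) H.read_meas
  sym := tEvent_sym_cubes (sitesPerDir_top_eq F hm₁ K) (tmpl := fun l => f ⁻¹' {l}) fun l _ i =>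
    preimage_fibre_eq_of_reader (H.read_sym i) l
  univ_le l hl :=
    (congrArg (gibbsTower D g₀ K).real
      (iInter_univ_labelSet (fun ω c => f (towerTranslate K (cubeCorner (sitesPerDir_top_eq F hm₁ K) c) ω))
        l)).trans_le (H.univ_le l hl)
  r_nonneg := H.r_nonneg

/-- … hence, for EVERY loop string, W7's eleven-clause `GibbsCubeSide` with the weights DEFINED by `weight`
(`repr := rfl` inside W7 v1.1's `GibbsCubeEvents.side`). [folklore] -/
theorem GibbsReaderEvents.side (H : GibbsReaderEvents D g₀ hm₁ K P T Bad term f r) (os : List (ULoop F)) :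
    GibbsCubeSide D g₀ os hm₁ K P T (weight D g₀ os K fun τ => term ⁻¹' {τ}) Bad (fun τ => term ⁻¹' {τ})
      (fun l c => {ω | f (towerTranslate K (cubeCorner (sitesPerDir_top_eq F hm₁ K) c) ω) = l}) r :=
  H.gibbsCubeEvents.side os

/-- the term events are measurable (W-E1's `hmeas` shape). [folklore] -/
theorem GibbsReaderEvents.ev_meas (H : GibbsReaderEvents D g₀ hm₁ K P T Bad term f r) :
    ∀ τ ∈ T, MeasurableSet (term ⁻¹' {τ}) :=
  H.term_meas

/-- the term events cover the tower (W-E1's `hcover` shape). [folklore] -/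
theorem GibbsReaderEvents.ev_cover (H : GibbsReaderEvents D g₀ hm₁ K P T Bad term f r) :
    Set.univ ⊆ ⋃ τ ∈ T, term ⁻¹' {τ} :=
  cover_fibre H.range

/-- all term events are pairwise disjoint (W-E1's `hdisj` shape; Mathlib's `Set.pairwiseDisjoint_fiber`). [folklore] -/
theorem GibbsReaderEvents.ev_disj (_H : GibbsReaderEvents D g₀ hm₁ K P T Bad term f r) :
    (↑T : Set ι).PairwiseDisjoint fun τ => term ⁻¹' {τ} :=
  Set.pairwiseDisjoint_fiber term _

end

end Summit.QuantumFields.BalabanUV.T4Continuum.HistoryChessboardLabelsGibbsReader
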